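import Literature.MathematicalPhysics.QuantumLattice.StabilitySmoothingCoreProofs
import Literature.MathematicalPhysics.QuantumLattice.StabilitySpectralFlowProofs
import HarnessLib

/-!
# `michalakis_zwolak` from the locality estimates alone (spectral flow discharged)

Top-down layer of the formalisation of the Michalakis–Zwolak stability theorem (hubbard.S19,
`Literature.MathematicalPhysics.QuantumLattice.michalakis_zwolak`). The reduction
`michalakis_zwolak_of_flow_locality_core'` (`StabilitySmoothingCoreProofs`) asks the analytic
side for two things: Hastings' spectral flow, and the term-wise quasi-locality (with `O(ε)`
control) of the rotated smoothed terms. The first is supplied here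
(`exists_spectral_flow_of_weight`, from `hasDerivAt_clusterProj_count` and
`exists_unitary_flow`) for the affine path `H_t = H₀ + t X`, `H₀ = Σ_Z Φ Z`, `X = ε Σ_Z V Z`,
under the `γ/2`-gap along `[0, s]`, with ONE weight `W` (`exists_spectralFlowWeight (γ/4)`)
fixed before the volume, the coupling and `s`; the flow `U(t)` is handed to the analytic side
through its defining data (`U(0) = 1`, `∂_t U = i D(t) U` on `[0, s]` with
`D(t) = ∫ W(τ) τ_τ^{H_t}(X) dτ`, unitarity), which is exactly the input format of the flow
Lieb–Robinson bounds (`FlowLiebRobinsonProofs`, `FlowQuasiLocalityProofs`,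
`FlowWeightedLiebRobinsonProofs`).

The remaining hypothesis of `michalakis_zwolak_of_locality_core` is therefore MZ13 Lemma 1 (v)
and Lemma 2 in the following pure form: for every Schwartz filter `w` (`∫ w = 1`, `ŵ = 0` off
`γ/2`, real) and every flow weight `W` (measurable, moments, integrable, `∫ e^{iτΔ}W = i/Δ` off
`γ/4`, real) there are `L_A` and an envelope `B_p` such that for `|ε| ≤ 1`, `L ≥ L_A`,
`s ∈ [0,1]` with the `γ/2`-gap along `[0, s]`, and every flow `U : ℝ → Op` with the above data,
there are term-wise Hermitian decompositions on the balls `cellBall (c Z) ℓ` (`ℓ ≤ L`, centres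
containing the terms) of `U(s)ᴴ 𝓕^s(Φ Z) U(s) − 𝓕⁰(Φ Z)` with norms `≤ |ε| B_p/(ℓ+1)^p` and of
`U(s)ᴴ 𝓕^s(V Z) U(s)` with norms `≤ B_p/(ℓ+1)^p`, where `𝓕^s(O) = ∫ w(t) τ_t^{H_s}(O) dt`,
`𝓕⁰(O) = ∫ w(t) τ_t^{H₀}(O) dt`. Also proved here: the count-defined cluster projection of `H₀`
is `P₀` (`clusterProj_zero_eq_localGroundProj`). No definitions, no named facts (theorems only).
-/

noncomputable section

open Matrix Finset Module MeasureTheory Complex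
open scoped InnerProductSpace ComplexOrder Matrix.Norms.L2Operator SchwartzMap

namespace Literature.MathematicalPhysics.QuantumLattice

open Literature.Probability.LatticeModels

/-! ### The spectral flow for a prescribed weight -/

section Flow

variable {n : Type*} [Fintype n] [DecidableEq n]

/-- **The spectral flow of a gapped affine path, for a prescribed weight.** As
`exists_spectral_flow_data_of_clusterGap`, but with the weight `W` of the generator given
(integrable, `∫ e^{iτΔ} W = i/Δ` for `|Δ| ≥ g/2`, real-valued) rather than produced: along
`H_t = H₀ + tX` with an `m`-cluster gap `≥ g` on `[0, T]` there is `U : ℝ → M_n(ℂ)` with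
`U(0) = 1`, `∂_t U = i (∫ W(τ) τ_τ^{H_t}(X) dτ) U` within `[0, T]`, `U(t)` unitary and
`U(t)ᴴ P(t) U(t) = P(0)` (`P(t)` the count-defined `m`-cluster projection), `t ∈ [0, T]`.
Fixing `W` once and for all makes the Lieb–Robinson constants of the flow independent of the
volume and the coupling. [cite: MichalakisZwolakCMP2013, §5.2 (arXiv:1109.1588 pp. 10–12)] -/
theorem exists_spectral_flow_of_weight {H₀ X : Matrix n n ℂ} (hH₀ : H₀.IsHermitian)
    (hX : X.IsHermitian) {m : ℕ} {g T : ℝ} {W : ℝ → ℂ} (hWi : Integrable W)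
    (hW : ∀ Δ : ℝ, g / 2 ≤ |Δ| → ∫ t : ℝ, cexp (t * Δ * I) * W t = I / Δ)
    (hWr : ∀ t : ℝ, starRingEnd ℂ (W t) = W t)
    (hgap : ∀ t ∈ Set.Icc (0 : ℝ) T, ∃ ω : ℝ, (H₀ + t • X).HasClusterGap m ω g) :
    ∃ U : ℝ → Matrix n n ℂ, U 0 = 1 ∧
      (∀ t ∈ Set.Icc (0 : ℝ) T, HasDerivWithinAt U
        (((Complex.I : ℂ) • ∫ τ : ℝ, W τ • heisenbergEvolution (H₀ + t • X) τ X) * U t)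
        (Set.Icc 0 T) t) ∧
      (∀ t ∈ Set.Icc (0 : ℝ) T, (U t)ᴴ * U t = 1) ∧ (∀ t ∈ Set.Icc (0 : ℝ) T, U t * (U t)ᴴ = 1) ∧
      (∀ t ∈ Set.Icc (0 : ℝ) T, (U t)ᴴ * projMatrix (Submodule.span ℂ (Set.range fun i :
          (univ.filter fun k => (univ.filter fun l =>
            (isHermitian_affinePath hH₀ hX t).eigenvalues l ≤
              (isHermitian_affinePath hH₀ hX t).eigenvalues k).card ≤ m) =>
            (isHermitian_affinePath hH₀ hX t).eigenvectorBasis i)) * U t =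
        projMatrix (Submodule.span ℂ (Set.range fun i :
          (univ.filter fun k => (univ.filter fun l =>
            (isHermitian_affinePath hH₀ hX 0).eigenvalues l ≤
              (isHermitian_affinePath hH₀ hX 0).eigenvalues k).card ≤ m) =>
            (isHermitian_affinePath hH₀ hX 0).eigenvectorBasis i))) := by
  set hHt := isHermitian_affinePath hH₀ hX with hhHt
  set D : ℝ → Matrix n n ℂ := fun t => ∫ τ : ℝ, W τ • heisenbergEvolution (H₀ + t • X) τ X with hDdef
  have hDc : Continuous D := continuous_integral_smul_heisenbergEvolution_affine hH₀ hX hWi X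
  have hDM : ∀ t, ‖D t‖ ≤ (∫ τ : ℝ, ‖W τ‖) * ‖X‖ := fun t =>
    norm_integral_smul_heisenbergEvolution_affine_le hH₀ hX W X t
  have hDh : ∀ t, (D t).IsHermitian := fun t =>
    isHermitian_integral_smul_heisenbergEvolution (hHt t) hX hWi hWr
  set P : ℝ → Matrix n n ℂ := fun t => projMatrix (Submodule.span ℂ (Set.range fun i :
      (univ.filter fun k => (univ.filter fun l =>
        (hHt t).eigenvalues l ≤ (hHt t).eigenvalues k).card ≤ m) => (hHt t).eigenvectorBasis i))
    with hPdef
  rcases isEmpty_or_nonempty n with hn | hn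
  · refine ⟨fun _ => 1, rfl, fun t _ => ?_, fun t _ => Subsingleton.elim _ _,
      fun t _ => Subsingleton.elim _ _, fun t _ => Subsingleton.elim _ _⟩
    have : ((Complex.I : ℂ) • ∫ τ : ℝ, W τ • heisenbergEvolution (H₀ + t • X) τ X) * 1 = 0 :=
      Subsingleton.elim _ _
    rw [this]
    exact hasDerivWithinAt_const _ _ _
  have hP : ∀ s ∈ Set.Icc (0 : ℝ) T,
      HasDerivWithinAt P ((Complex.I : ℂ) • (D s * P s - P s * D s)) (Set.Icc 0 T) s := by
    intro s hs
    obtain ⟨ω, hω⟩ := hgap s hs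
    exact (hasDerivAt_clusterProj_count hH₀ hX hω hWi hW).hasDerivWithinAt
  obtain ⟨U, hU0, hUd, hU1, hU2, hUP⟩ := exists_unitary_flow hDc hDM hDh T hP
  exact ⟨U, hU0, hUd, hU1, hU2, hUP⟩

end Flow

/-! ### The cluster projection at `t = 0` is `P₀` -/

section Zero

variable {d L : ℕ} [NeZero L] {κ : Type*} [Fintype κ] [DecidableEq κ] {q : ℕ}

/-- **The count-defined `m`-cluster projection of `H₀` is the ground-state projection.** For a
projector interaction with Local-Gap and the cluster gap `HasClusterGap m 0 γ` at the whole
torus, and any Hermitian `H` propositionally equal to `H_univ` which has an `m`-cluster gap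
(e.g. `H = Σ_Z Φ Z + 0 • X`), the projection onto the eigenvectors of the count-defined cluster
set of `H` is `localGroundProj Φ univ`. [cite: MichalakisZwolakCMP2013, §4 Corollary 1 (2) (arXiv:1109.1588 p. 7)] -/
theorem clusterProj_zero_eq_localGroundProj {Φ : Interaction (TorusSite d L × κ) q}
    (hproj : IsProjectorInteraction Φ) {γloc : ℕ → ℝ} (hloc : HasLocalGap Φ γloc)
    (hγL : 0 < γloc L) {m : ℕ} {γ : ℝ}
    (hgapL : (localHamiltonian Φ univ).HasClusterGap m 0 γ)
    {H : Op (TorusSite d L × κ) q} (e : H = localHamiltonian Φ univ) (hH : H.IsHermitian)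
    {ω g : ℝ} (hgapH : H.HasClusterGap m ω g) :
    projMatrix (Submodule.span ℂ (Set.range fun i :
        (univ.filter fun k => (univ.filter fun l => hH.eigenvalues l ≤ hH.eigenvalues k).card ≤ m) =>
          hH.eigenvectorBasis i)) = localGroundProj Φ univ := by
  rcases isEmpty_or_nonempty (TensorIndex (TorusSite d L × κ) q) with hn | hn
  · exact Subsingleton.elim _ _
  subst e
  -- the count-defined set is `{λ ≤ E₀ + ω}` and also `{λ ≤ E₀}` (equal cardinalities)
  have h1 := clusterSet_eq_filter hH hgapH
  have hcardω : (univ.filter fun k => hH.eigenvalues k ≤ (⨅ j, hH.eigenvalues j) + ω).card = m := by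
    rw [← h1]; exact card_clusterSet hH hgapH
  have hcard0 : (univ.filter fun k => hH.eigenvalues k ≤ (⨅ j, hH.eigenvalues j) + 0).card = m :=
    hgapL.2.2.2.1
  have h2 := filter_le_eq_of_card_eq hH.eigenvalues (hcardω.trans hcard0.symm)
  -- `E₀ = 0`
  have x₀ : TorusSite d L := fun _ => 0
  have hg := hloc x₀ L
  rw [cellBall_side x₀] at hg
  have hE0 : (⨅ j, hH.eigenvalues j) = 0 := hproj.iInf_eigenvalues_eq_zero hg
  rw [h1, h2, hE0, add_zero]
  exact (localGroundProj_univ_eq_projMatrix_span hproj hloc hH le_rfl hγL).symm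

end Zero

/-! ### The reduction -/

section Core

universe u

variable (d q : ℕ) {κ : Type u} [Fintype κ] [DecidableEq κ]

/-- **`michalakis_zwolak` from the locality estimates (MZ13 Lemma 1 (v) + Lemma 2).** See the
module docstring for the precise remaining hypothesis `hL`: the Schwartz filter `w` and the
flow weight `W` are fixed first, then the threshold `L_A` and the envelope `Bd`, then the
coupling, the volume, `s` and the flow `U` (given only through its defining data).
[cite: MichalakisZwolakCMP2013, Thm. 1, §5.1–5.2 (arXiv:1109.1588 pp. 6–12)] -/
theorem michalakis_zwolak_of_locality_core
    (hL : ∀ (Φ : (L : ℕ) → Interaction (TorusSite d L × κ) q) (m : ℕ → ℕ) (γ : ℝ) (r₀ : ℕ)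
      (Δ γloc : ℕ → ℝ),
      (∀ (L : ℕ) [NeZero L], IsProjectorInteraction (Φ L) ∧ (Φ L).IsLocal) →
      (∀ (L : ℕ) [NeZero L], IsFrustrationFree (Φ L) univ) →
      (∀ (L : ℕ) [NeZero L] (X : Finset (TorusSite d L × κ)), r₀ < torusDiam X → Φ L X = 0) →
      (0 < γ ∧ ∀ (L : ℕ) [NeZero L], (localHamiltonian (Φ L) univ).HasClusterGap (m L) 0 γ) →
      HasUniformLTQO Φ Δ → HasFastDecay Δ → HasUniformLocalGap Φ γloc →
      (∃ c : ℝ, ∃ p : ℕ, 0 < c ∧ ∀ ℓ : ℕ, c / ((ℓ : ℝ) + 1) ^ p ≤ γloc ℓ) →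
      ∀ (r : ℕ) (V : (L : ℕ) → Interaction (TorusSite d L × κ) q),
        (∀ (L : ℕ) [NeZero L], (V L).IsLocal ∧
          (∀ X, r < torusDiam X → V L X = 0) ∧ ∀ X, ‖V L X‖ ≤ 1) →
        ∀ w : 𝓢(ℝ, ℂ), (∫ t : ℝ, w t) = 1 →
          (∀ D : ℝ, γ / 2 ≤ |D| → ∫ t : ℝ, cexp (t * D * I) * w t = 0) →
          (∀ t : ℝ, starRingEnd ℂ (w t) = w t) →
        ∀ W : ℝ → ℂ, AEStronglyMeasurable W volume →
          (∀ k : ℕ, ∃ M : ℝ, ∀ t : ℝ, |t| ^ k * ‖W t‖ ≤ M) →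
          (∀ k : ℕ, Integrable fun t : ℝ => ‖t‖ ^ k * ‖W t‖) → Integrable W →
          (∀ D : ℝ, γ / 4 ≤ |D| → ∫ t : ℝ, cexp (t * D * I) * W t = I / D) →
          (∀ t : ℝ, starRingEnd ℂ (W t) = W t) →
        ∃ L_A : ℕ, ∃ Bd : ℕ → ℝ,
          ∀ ε : ℝ, |ε| ≤ 1 → ∀ (L : ℕ) [NeZero L], L_A ≤ L → ∀ s ∈ Set.Icc (0 : ℝ) 1,
            (∀ t ∈ Set.Icc (0 : ℝ) s, ∃ ω : ℝ, ω ≤ γ ∧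
              (localHamiltonian (Φ L) univ +
                (t : ℂ) • ((ε : ℂ) • localHamiltonian (V L) univ)).HasClusterGap (m L) ω (γ / 2)) →
            ∀ U : ℝ → Op (TorusSite d L × κ) q, U 0 = 1 →
              (∀ t ∈ Set.Icc (0 : ℝ) s, HasDerivWithinAt U
                (((Complex.I : ℂ) • ∫ τ : ℝ, W τ • heisenbergEvolution
                    (∑ Z, Φ L Z + t • ((ε : ℂ) • ∑ Z, V L Z)) τ ((ε : ℂ) • ∑ Z, V L Z)) * U t)
                (Set.Icc 0 s) t) →
              (∀ t ∈ Set.Icc (0 : ℝ) s, (U t)ᴴ * U t = 1) →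
              (∀ t ∈ Set.Icc (0 : ℝ) s, U t * (U t)ᴴ = 1) →
              ∃ (c₁ c₂ : Finset (TorusSite d L × κ) → TorusSite d L)
                (A B : Finset (TorusSite d L × κ) → ℕ → Op (TorusSite d L × κ) q),
                (∀ Z, Φ L Z ≠ 0 → Z ⊆ cellBall (c₁ Z) r₀) ∧
                (∀ Z, V L Z ≠ 0 → Z ⊆ cellBall (c₂ Z) r) ∧
                (∀ Z, Φ L Z ≠ 0 → ∑ ℓ ∈ range (L + 1), A Z ℓ =
                  star (U s) * (∫ t : ℝ, w t • heisenbergEvolution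
                    (∑ Z, Φ L Z + s • ((ε : ℂ) • ∑ Z, V L Z)) t (Φ L Z)) * U s -
                    ∫ t : ℝ, w t • heisenbergEvolution (∑ Z, Φ L Z) t (Φ L Z)) ∧
                (∀ Z, V L Z ≠ 0 → ∑ ℓ ∈ range (L + 1), B Z ℓ =
                  star (U s) * (∫ t : ℝ, w t • heisenbergEvolution
                    (∑ Z, Φ L Z + s • ((ε : ℂ) • ∑ Z, V L Z)) t (V L Z)) * U s) ∧
                (∀ Z ℓ, IsSupportedOn (A Z ℓ) (cellBall (c₁ Z) ℓ)) ∧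
                (∀ Z ℓ, IsSupportedOn (B Z ℓ) (cellBall (c₂ Z) ℓ)) ∧
                (∀ Z ℓ, (A Z ℓ).IsHermitian) ∧ (∀ Z ℓ, (B Z ℓ).IsHermitian) ∧
                (∀ Z ℓ (p : ℕ), ‖A Z ℓ‖ ≤ |ε| * (Bd p / ((ℓ : ℝ) + 1) ^ p)) ∧
                (∀ Z ℓ (p : ℕ), ‖B Z ℓ‖ ≤ Bd p / ((ℓ : ℝ) + 1) ^ p)) :
    michalakis_zwolak (κ := κ) d q := by
  refine michalakis_zwolak_of_flow_locality_core' d q ?_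
  intro Φ m γ r₀ Δ γloc hproj hff hrange hgap hltqo hΔ hloc hγloc r V hV w hw1 hw2 hw3
  have hγ : 0 < γ := hgap.1
  -- one flow weight for all volumes and couplings
  have hγ4 : 0 < γ / 4 := by positivity
  obtain ⟨W, hWm, hWmom, hWmomi, hWi, hW, hWr⟩ := exists_spectralFlowWeight hγ4
  obtain ⟨L_A, Bd, hcore⟩ := hL Φ m γ r₀ Δ γloc hproj hff hrange hgap hltqo hΔ hloc hγloc r V hV
    w hw1 hw2 hw3 W hWm hWmom hWmomi hWi hW hWr
  refine ⟨L_A, Bd, ?_⟩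
  intro ε hε L _ hL1 s hs hprev
  -- the affine path `H_t = H₀' + t X'`
  set H₀' : Op (TorusSite d L × κ) q := ∑ Z, Φ L Z with hH₀'def
  set X' : Op (TorusSite d L × κ) q := (ε : ℂ) • ∑ Z, V L Z with hX'def
  have hH₀eq : localHamiltonian (Φ L) univ = H₀' := localHamiltonian_univ_eq_sum _
  have hV₁eq : localHamiltonian (V L) univ = ∑ Z, V L Z := localHamiltonian_univ_eq_sum _
  have hH₀'h : H₀'.IsHermitian := by
    rw [← hH₀eq]; exact localHamiltonian_isHermitian (hproj L).2 univ
  have hV₁h : (∑ Z, V L Z).IsHermitian := by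
    rw [← hV₁eq]; exact localHamiltonian_isHermitian (hV L).1 univ
  have hX'h : X'.IsHermitian := isHermitian_ofReal_smul hV₁h ε
  -- the two syntactic forms of the perturbed Hamiltonian
  have hpath : ∀ t : ℝ, localHamiltonian (Φ L) univ +
      (t : ℂ) • ((ε : ℂ) • localHamiltonian (V L) univ) = H₀' + t • X' := by
    intro t
    rw [hH₀eq, hV₁eq, Complex.coe_smul]
  have hHsEq : (∑ Z, Φ L Z + ((s * ε : ℝ) : ℂ) • ∑ Z, V L Z) = H₀' + s • X' := by
    rw [hX'def, ← Complex.coe_smul, smul_smul, ← Complex.ofReal_mul]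
  -- the gap along the path in affine form
  have hgap' : ∀ t ∈ Set.Icc (0 : ℝ) s, ∃ ω : ℝ, (H₀' + t • X').HasClusterGap (m L) ω (γ / 2) := by
    intro t ht
    obtain ⟨ω, -, hω⟩ := hprev t ht
    exact ⟨ω, by rwa [hpath t] at hω⟩
  -- the spectral flow for the fixed weight
  have hW' : ∀ D : ℝ, γ / 2 / 2 ≤ |D| → ∫ t : ℝ, cexp (t * D * I) * W t = I / D := by
    intro D hD; exact hW D (by linarith)
  obtain ⟨U, hU0, hUd, hU1, hU2, hUP⟩ :=
    exists_spectral_flow_of_weight hH₀'h hX'h hWi hW' hWr hgap'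
  -- the locality estimates from the analytic side, for this flow
  obtain ⟨c₁, c₂, A, B, hc₁, hc₂, hAsum, hBsum, hAs, hBs, hAh, hBh, hAn, hBn⟩ :=
    hcore ε hε L hL1 s hs hprev U hU0 hUd hU1 hU2
  have hsmem : s ∈ Set.Icc (0 : ℝ) s := ⟨hs.1, le_rfl⟩
  have hUs : U s ∈ unitary (Op (TorusSite d L × κ) q) := by
    rw [Unitary.mem_iff, star_eq_conjTranspose]; exact ⟨hU1 s hsmem, hU2 s hsmem⟩
  set hHt := isHermitian_affinePath hH₀'h hX'h with hhHt
  refine ⟨U s, (univ.filter fun k => (univ.filter fun l =>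
      (hHt s).eigenvalues l ≤ (hHt s).eigenvalues k).card ≤ m L), c₁, c₂, A, B, hUs, ?_, hc₁, hc₂,
    ?_, ?_, hAs, hBs, hAh, hBh, hAn, hBn⟩
  · -- separation and intertwining
    intro hHs
    have hev : hHs.eigenvalues = (hHt s).eigenvalues := eigenvalues_eq_of_eq hHsEq hHs (hHt s)
    have heb : hHs.eigenvectorBasis = (hHt s).eigenvectorBasis :=
      IsHermitian.eigenvectorBasis.congr_simp hHsEq hHs
    obtain ⟨ωs, hωs⟩ := hgap' s hsmem
    refine ⟨?_, ?_⟩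
    · rw [hev]
      exact clusterSet_separated (hHt s) hωs
    · rw [heb, star_eq_conjTranspose, hUP s hsmem]
      -- the cluster projection at `t = 0` is `P₀`
      obtain ⟨ω0, hω0⟩ := hgap' 0 ⟨le_rfl, hs.1⟩
      have e0 : H₀' + (0 : ℝ) • X' = localHamiltonian (Φ L) univ := by
        rw [zero_smul, add_zero, hH₀eq]
      obtain ⟨c₀, p₀, hc₀, hγloc'⟩ := hγloc
      exact clusterProj_zero_eq_localGroundProj (hproj L).1 (hloc L)
        (lt_of_lt_of_le (by positivity) (hγloc' L)) (hgap.2 L) e0 (hHt 0) hω0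
  · -- the `Φ`-terms: same statement up to the syntactic form of `H_s`
    intro Z hZ
    rw [hAsum Z hZ, hHsEq]
  · intro Z hZ
    rw [hBsum Z hZ, hHsEq]

end Core

end Literature.MathematicalPhysics.QuantumLattice
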